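import Mathlib
import Literature.NumberTheory.LFunctions.Zhang2022.Section10RangeAverage
import HarnessLib

/-!
# Zhang (2022) §10: the printed "second line" `(500L′²/(θ log²P))Σ… = (500𝔞/(θ log P))∫_a^b … dz + o(α)`
# from the range-average rule (part 3/3 of the engine)

Topic `Literature/NumberTheory/LFunctions/Zhang2022` (Landau–Siegel audit tree; verdict-neutral).
Y. Zhang, *Discrete mean estimates and the Landau–Siegel zero*, arXiv:2211.02515v1 (2022)
[Zhang2022LandauSiegel] — **an unrefereed manuscript under adjudication**; theorem-only TOOL file
(campaign siegel-zhang, L3 LEDGER #11 "generic range-average engine", part 3/3, no DAG node).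
Every range evaluation of §10 closes with a display of the shape
`(500L′(1,χ)²/(θ log²P)) Σ_{P^a≤n<P^b} |χ(n)|λ₀ⱼ(n)φ(n)⁻¹ F(n) = (500𝔞/(θ log P))∫_a^b G₀(z)dz + o(α)`
[Z22 pp. 57–61, the displays before (10.12)–(10.15): typed `Typed.Sec10B.Eq1036b/1037b/1038b/1043b/1044b`,
`Typed.Sec10C.Eq1049b/…`], where `G₀(z)` is the "direct calculation" main value of `F(P^z)`
(`β_j log P^{z−0.5} → πij(z−0.5)`, `𝔤_{jμ}(P^{θ−z}) → 𝔤𝔥_{jμ}(θ−z)`, …, each `+ O(𝓛⁻⁸)`).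

* `integral_div_eq_log_mul_integral_rpow` — `∫_{P^a}^{P^b}F(t)dt/t = log P·∫_a^b F(P^z)dz`;
* `frakA_eq_frakcD_mul_sq`, `norm_frakA_le_sq`, `norm_deriv_LFunction_one_le_sq` — `𝔞 = 𝔠_D L′(1,χ)²`
  (tree `Lemma171.frakAC_eq`), `|L′(1,χ)| ≤ 4e^{9/2}𝓛²` (tree `Lemma31.norm_deriv_LFunction_le_near_one`);
* `second_line` — **the packaged rule**: under Z22:§8.u047/§8.u048 (hypotheses), for fixed `θ > 0`,
  `0 ≤ a ≤ b < 1`, `M, M′, C₀ ≥ 0`, every `ε > 0`, all large `D`, `j ∈ {1,2,3}`, and every `F` with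
  `‖F‖ ≤ M`, `‖F′(t)‖ ≤ M′α/t` on `[P^a, P^b]`, `‖F(P^z) − G₀(z)‖ ≤ C₀𝓛⁻⁸` on `[a, b]`:
  `‖(500L′²/(θ log²P))·nAvg(P^a, P^b, F) − (500𝔞/(θ log P))∫_a^b G₀‖ ≤ εα`
  (from `RangeAverage.nAvg_eval`, part 2/3; the error is `O(𝓛⁴·𝓛·𝓛⁻¹⁸ + 𝓛⁴·𝓛⁻⁸·𝓛⁻⁹) = O(𝓛⁻¹³) = o(𝓛⁻⁹)`).

Consumers (L3 b-line holders) supply only: the profile `F` with its `O(1)`, `O(α/t)` bounds (cf.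
`Section8AbelProfiles.frakgW_div_bounds`, `mul_bounds`) and the pointwise main-value approximation
`G₀` (cf. `Section10DirectCalculation`, `Section8dStatements.Step8u049/u050`); `θ` is cast from `ℝ`
(`((0.504 : ℝ) : ℂ) = 0.504` by `norm_num`) and `logP = Typed.Sec10B.logP` is `Real.log (bigP D)` by `rfl`.
Nothing about the manuscript's Theorems 1–2 is asserted; (A) is not used.

## References

* Y. Zhang, arXiv:2211.02515v1 (2022), §10 pp. 57–61; §2 (2.31); §8 (8.11) p. 48.
  [cite: Zhang2022LandauSiegel, §10 pp. 57–61]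
-/

noncomputable section

open Complex Real MeasureTheory Set Finset
open Literature.NumberTheory.LFunctions.Zhang2022.Skeleton
open Literature.NumberTheory.LFunctions.Zhang2022.Typed

namespace Literature.NumberTheory.LFunctions.Zhang2022.RangeAverage

/-! ### `x = P^z` and the packaging to the printed "second line" shape -/

/-- `D ≥ 21 ⇒ 𝓛 = log D ≥ 3` (`e³ < 20.1`; cf. `Section8Ded823.three_le_ell`). [folklore] -/
private theorem three_le_ell' {D : ℕ} (hD : 21 ≤ D) : 3 ≤ ell D := by
  rw [ell, Real.le_log_iff_exp_le (by positivity)]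
  have h21 : (21 : ℝ) ≤ D := by exact_mod_cast hD
  have he := Real.exp_one_lt_d9
  have he0 := Real.exp_pos 1
  have h3 : Real.exp 3 = Real.exp 1 ^ 3 := by rw [← Real.exp_nat_mul]; norm_num
  have h4 : Real.exp 1 ^ 3 < (2.7182818286 : ℝ) ^ 3 := by gcongr
  rw [h3]; norm_num at h4; linarith


/-- The substitution `t = P^z`: for `P > 1`, `a ≤ b` and `F` continuous on `[P^a, P^b]`,
`∫_{P^a}^{P^b} F(t)dt/t = log P · ∫_a^b F(P^z)dz` — the manuscript's "substituting `x = P^z`"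
(p. 57, before (10.12)). [cite: Zhang2022LandauSiegel, §10 p. 57] -/
theorem integral_div_eq_log_mul_integral_rpow {P a b : ℝ} (hP : 1 < P) (hab : a ≤ b) {F : ℝ → ℂ}
    (hF : ContinuousOn F (Set.Icc (P ^ a) (P ^ b))) :
    ∫ t in (P ^ a)..(P ^ b), F t / t = Real.log P * ∫ z in a..b, F (P ^ z) := by
  have hP0 : 0 < P := by linarith
  set f : ℝ → ℝ := fun z => P ^ z with hf
  set f' : ℝ → ℝ := fun z => P ^ z * Real.log P with hf'
  have hfd : ∀ z ∈ Set.uIcc a b, HasDerivAt f (f' z) z := fun z _ =>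
    (Real.hasStrictDerivAt_const_rpow hP0 z).hasDerivAt
  have hf'c : ContinuousOn f' (Set.uIcc a b) :=
    ((Real.continuous_const_rpow hP0.ne').mul continuous_const).continuousOn
  have himg : f '' Set.uIcc a b ⊆ Set.Icc (P ^ a) (P ^ b) := by
    rw [Set.uIcc_of_le hab]
    rintro _ ⟨z, hz, rfl⟩
    exact ⟨Real.rpow_le_rpow_of_exponent_le hP.le hz.1, Real.rpow_le_rpow_of_exponent_le hP.le hz.2⟩
  have hne : ∀ t ∈ Set.Icc (P ^ a) (P ^ b), t ≠ 0 := fun t ht =>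
    (lt_of_lt_of_le (Real.rpow_pos_of_pos hP0 a) ht.1).ne'
  have hg : ContinuousOn (fun t : ℝ => F t / t) (f '' Set.uIcc a b) :=
    (hF.div (Complex.continuous_ofReal.continuousOn) (fun t ht => by exact_mod_cast hne t ht)).mono himg
  have key := intervalIntegral.integral_deriv_smul_comp' hfd hf'c hg
  -- `key : ∫ z in a..b, f′ z • (F(P^z)/P^z) = ∫ t in P^a..P^b, F t / t`
  simp only [hf, hf', Function.comp] at key
  rw [← key, ← intervalIntegral.integral_const_mul]
  refine intervalIntegral.integral_congr fun z _ => ?_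
  have hPz : (((P ^ z : ℝ)) : ℂ) ≠ 0 := by exact_mod_cast (Real.rpow_pos_of_pos hP0 z).ne'
  simp only [Complex.real_smul]
  push_cast
  field_simp

/-- `|L′(1,χ)| ≤ 4e^{9/2}𝓛²` for `χ` primitive and `𝓛 ≥ 3` (tree `Lemma31.norm_deriv_LFunction_le_near_one`).
[cite: Zhang2022LandauSiegel, §2 (2.31)] -/
theorem norm_deriv_LFunction_one_le_sq {D : ℕ} [NeZero D] (χ : DirichletCharacter ℂ D)
    (hℓ : 3 ≤ ell D) (hp : χ.IsPrimitive) :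
    ‖deriv χ.LFunction 1‖ ≤ 4 * Real.exp (9 / 2) * ell D ^ 2 := by
  have h := Lemma31.norm_deriv_LFunction_le_near_one χ (show 3 ≤ Real.log D from hℓ) hp (w := 1)
    (by rw [sub_self, norm_zero]; positivity)
  rw [← ell] at h
  have h1 : (1 + ell D) * ell D ≤ 2 * ell D ^ 2 := by nlinarith
  calc _ ≤ 2 * Real.exp (9 / 2) * (1 + ell D) * ell D := h
    _ = 2 * Real.exp (9 / 2) * ((1 + ell D) * ell D) := by ring
    _ ≤ 2 * Real.exp (9 / 2) * (2 * ell D ^ 2) := by gcongr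
    _ = 4 * Real.exp (9 / 2) * ell D ^ 2 := by ring

/-- `𝔞 = 𝔠_D·L′(1,χ)²` as complex numbers (`χ ≠ 1` quadratic; the tree's `Lemma171.frakAC_eq`).
[cite: Zhang2022LandauSiegel, §2 (2.31)] -/
theorem frakA_eq_frakcD_mul_sq {D : ℕ} [NeZero D] (χ : DirichletCharacter ℂ D) (hχ1 : χ ≠ 1)
    (hq : χ.IsQuadratic) :
    (frakA χ : ℂ) = ((6 / π ^ 2 * ∏ q ∈ D.primeFactors, ((q : ℝ) / (q + 1)) : ℝ) : ℂ) *
      deriv χ.LFunction 1 ^ 2 := by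
  have h := Lemma171.frakAC_eq χ hχ1 (MulChar.IsQuadratic.sq_eq_one hq)
  rw [Skeleton.frakA, ← h, Lemma171.frakAC]
  push_cast
  ring

/-- `|𝔞| ≤ |L′(1,χ)|²` (`0 ≤ 𝔠_D ≤ 1`). [cite: Zhang2022LandauSiegel, §2 (2.31)] -/
theorem norm_frakA_le_sq {D : ℕ} [NeZero D] (χ : DirichletCharacter ℂ D) (hχ1 : χ ≠ 1)
    (hq : χ.IsQuadratic) : ‖(frakA χ : ℂ)‖ ≤ ‖deriv χ.LFunction 1‖ ^ 2 := by
  rw [frakA_eq_frakcD_mul_sq χ hχ1 hq, norm_mul, norm_pow, Complex.norm_real, Real.norm_eq_abs,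
    abs_of_nonneg (frakcD_bounds D).1]
  calc _ ≤ 1 * ‖deriv χ.LFunction 1‖ ^ 2 := by gcongr; exact (frakcD_bounds D).2
    _ = _ := one_mul _

/-- **The printed "second line" shape.** Under Z22:§8.u047/§8.u048, fix `θ > 0`, a window of
exponents `0 ≤ a ≤ b < 1` and constants `M, M′, C₀ ≥ 0`. Then for every `ε > 0`, for all large `D`
and every `j ∈ {1,2,3}`: whenever `F` is differentiable on `[P^a, P^b]` with `‖F‖ ≤ M`,
`‖F′(t)‖ ≤ M′α/t`, and `G₀` is integrable on `[a, b]` with `‖F(P^z) − G₀(z)‖ ≤ C₀𝓛⁻⁸` there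
(the "direct calculation" main values, e.g. `β_j log P^{z−0.5} → πij(z − 0.5)`,
`𝔤_{j6}(P^{0.504−z}) → 𝔤𝔥_{j6}(0.504 − z)`), one has
`‖(500L′(1,χ)²/(θ log²P))·Σ_{P^a≤n<P^b}|χ(n)|λ₀ⱼ(n)φ(n)⁻¹F(n) − (500𝔞/(θ log P))∫_a^b G₀(z)dz‖ ≤ εα`
— the manuscript's "`= (500𝔞/(θ log P))∫_a^b … dz + o(α)`".
[cite: Zhang2022LandauSiegel, §10 pp. 57–61 (displays before (10.12)–(10.15))] -/
theorem second_line {c' : ℝ} (h47 : Section8cStatements.Step8u047 c')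
    (h48 : Section8cStatements.Step8u048) {θ a b M M' C₀ : ℝ} (hθ : 0 < θ) (ha : 0 ≤ a)
    (hab : a ≤ b) (hb : b < 1) (hM : 0 ≤ M) (hM' : 0 ≤ M') (hC₀ : 0 ≤ C₀) :
    ∀ ε : ℝ, 0 < ε → ForAllLarge fun D _ χ => ∀ j ∈ ({1, 2, 3} : Finset ℕ),
      ∀ (F G₀ : ℝ → ℂ),
        (∀ t ∈ Set.Icc (bigP D ^ a) (bigP D ^ b), DifferentiableAt ℝ F t) →
        (∀ t ∈ Set.Icc (bigP D ^ a) (bigP D ^ b), ‖F t‖ ≤ M) →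
        (∀ t ∈ Set.Icc (bigP D ^ a) (bigP D ^ b), ‖deriv F t‖ ≤ M' * alpha D / t) →
        IntervalIntegrable G₀ volume a b →
        (∀ z ∈ Set.Icc a b, ‖F (bigP D ^ z) - G₀ z‖ ≤ C₀ / ell D ^ 8) →
        ‖(500 : ℂ) * deriv χ.LFunction 1 ^ 2 / (θ * (Real.log (bigP D) : ℂ) ^ 2) *
              Sec10B.nAvg c' χ j (bigP D ^ a) (bigP D ^ b) (fun n => F n) -
            500 * (frakA χ : ℂ) / (θ * (Real.log (bigP D) : ℂ)) * ∫ z in a..b, G₀ z‖ ≤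
          ε * alpha D := by
  intro ε hε
  obtain ⟨C, hC0, D₀, hmain⟩ := nAvg_eval h47 h48
  -- the constants: `|L′| ≤ c_L 𝓛²`, total error `≤ K·𝓛⁻¹³`, `K = (500 c_L²/θ)(C₀ + C(M + πM′))`
  set cL : ℝ := 4 * Real.exp (9 / 2) with hcL
  set K : ℝ := 500 * cL ^ 2 / θ * (C₀ + C * (M + π * M')) with hK
  have hK0 : 0 ≤ K := by positivity
  refine ⟨max D₀ (max 21 ⌈Real.exp (K / (ε * π) + 1 / (1 - b) + 1)⌉₊),
    fun D _ χ hD hq hp j hj F G₀ hFd hF hF' hG₀ happrox => ?_⟩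
  have hD₀ : D₀ ≤ D := le_trans (le_max_left _ _) hD
  have hD21 : 21 ≤ D := le_trans (le_max_left _ _) (le_trans (le_max_right _ _) hD)
  have hDexp : (⌈Real.exp (K / (ε * π) + 1 / (1 - b) + 1)⌉₊ : ℝ) ≤ D := by
    exact_mod_cast le_trans (le_max_right _ _) (le_trans (le_max_right _ _) hD)
  have hℓ3 : 3 ≤ ell D := three_le_ell' hD21
  have hℓ0 : 0 < ell D := by linarith
  have hℓ1 : 1 ≤ ell D := by linarith
  have hb1 : 0 < 1 - b := by linarith
  have hℓbig : K / (ε * π) + 1 / (1 - b) + 1 ≤ ell D := by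
    rw [ell, Real.le_log_iff_exp_le (by positivity)]
    exact le_trans (Nat.le_ceil _) hDexp
  have hlogℓ : 1 ≤ Real.log (ell D) := one_le_log_ell hℓ3
  have hlogℓ' : Real.log (ell D) ≤ ell D := (Real.log_le_sub_one_of_pos hℓ0).trans (by linarith)
  have hP : 0 < bigP D := Real.exp_pos _
  have hP1 : 1 < bigP D := by rw [bigP]; exact Real.one_lt_exp_iff.2 (pow_pos hℓ0 9)
  have hlogP : Real.log (bigP D) = ell D ^ 9 := by rw [bigP, Real.log_exp]
  have hℓ9 : ell D ≤ ell D ^ 9 := by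
    calc ell D = ell D ^ 1 := (pow_one _).symm
      _ ≤ ell D ^ 9 := pow_le_pow_right₀ hℓ1 (by norm_num)
  have hα : alpha D = π / ell D ^ 9 := by rw [alpha, hlogP]
  have hα0 : 0 < alpha D := by rw [hα]; positivity
  have hχ1 : χ ≠ 1 := Lemma31.ne_one_of_isPrimitive χ (by omega) hp
  -- the window `[P^a, P^b]`
  set lo : ℝ := bigP D ^ a with hlo
  set hi : ℝ := bigP D ^ b with hhi
  have hlo1 : 1 ≤ lo := Real.one_le_rpow hP1.le ha
  have hlohi : lo ≤ hi := Real.rpow_le_rpow_of_exponent_le hP1.le hab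
  have hhiP : hi + 1 < bigP D := by
    -- `2 < P^{1-b}` since `log 2 < 1 ≤ (1-b)𝓛 ≤ (1-b)𝓛⁹`, so `hi + 1 ≤ 2hi < hi·P^{1-b} = P`
    have h1b : 1 ≤ (1 - b) * ell D := by
      have : 1 / (1 - b) ≤ ell D := by
        linarith [div_nonneg hK0 (by positivity : (0:ℝ) ≤ ε * π)]
      rwa [div_le_iff₀ hb1, mul_comm] at this
    have hexp : Real.log 2 < ell D ^ 9 * (1 - b) := by
      have hl2 := Real.log_two_lt_d9
      nlinarith [mul_le_mul_of_nonneg_right hℓ9 hb1.le]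
    have h2 : (2 : ℝ) < bigP D ^ (1 - b) := by
      rw [bigP, ← Real.exp_mul]
      calc (2 : ℝ) = Real.exp (Real.log 2) := (Real.exp_log (by norm_num)).symm
        _ < Real.exp (ell D ^ 9 * (1 - b)) := Real.exp_lt_exp.mpr hexp
    have hhi1 : 1 ≤ hi := Real.one_le_rpow hP1.le (ha.trans hab)
    have hhi0 : 0 < hi := by linarith
    have : hi * 2 < bigP D := by
      calc hi * 2 < hi * bigP D ^ (1 - b) := by gcongr
        _ = bigP D := by
            rw [hhi, ← Real.rpow_add hP]; norm_num
    linarith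
  -- (1) the engine
  have hFd'' : ∀ t ∈ Set.Icc lo hi, ‖deriv F t‖ ≤ M' * alpha D / t := hF'
  have hE := hmain D χ hD₀ hq hp j hj lo hi hlo1 hlohi hhiP F M (M' * alpha D) hM
    (by positivity) hFd hF hFd''
  set 𝔠 : ℝ := 6 / π ^ 2 * ∏ q ∈ D.primeFactors, ((q : ℝ) / (q + 1)) with h𝔠
  set I : ℂ := ∫ t in lo..hi, F t / t with hI
  set N : ℂ := Sec10B.nAvg c' χ j lo hi (fun n => F n) with hN
  have hloghl : Real.log (hi / lo) ≤ ell D ^ 9 := by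
    rw [hhi, hlo, ← Real.rpow_sub hP, Real.log_rpow hP, hlogP]
    have : (b - a) * ell D ^ 9 ≤ 1 * ell D ^ 9 := by gcongr; linarith
    linarith
  have hloghl0 : 0 ≤ Real.log (hi / lo) := Real.log_nonneg ((one_le_div (by linarith)).mpr hlohi)
  have hEbd : ‖N - (𝔠 : ℂ) * I‖ ≤ C * (M + π * M') * ell D := by
    refine hE.trans ?_
    have h1 : M' * alpha D * Real.log (ell D) * Real.log (hi / lo) ≤ π * M' * ell D := by
      calc M' * alpha D * Real.log (ell D) * Real.log (hi / lo)
          ≤ M' * alpha D * ell D * ell D ^ 9 :=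
            mul_le_mul (mul_le_mul_of_nonneg_left hlogℓ' (by positivity)) hloghl hloghl0
              (by positivity)
        _ = π * M' * ell D := by rw [hα]; field_simp
    nlinarith [mul_nonneg hC0 (sub_nonneg.mpr h1)]
  -- (2) the substitution and the main-value replacement
  have hFc : ContinuousOn F (Set.Icc lo hi) := fun t ht => (hFd t ht).continuousAt.continuousWithinAt
  have hsub : I = Real.log (bigP D) * ∫ z in a..b, F (bigP D ^ z) := by
    rw [hI, hlo, hhi]; exact integral_div_eq_log_mul_integral_rpow hP1 hab hFc
  have hFz : IntervalIntegrable (fun z => F (bigP D ^ z)) volume a b := by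
    refine (ContinuousOn.comp hFc ((Real.continuous_const_rpow hP.ne').continuousOn) ?_).intervalIntegrable_of_Icc hab
    intro z hz
    exact ⟨Real.rpow_le_rpow_of_exponent_le hP1.le hz.1, Real.rpow_le_rpow_of_exponent_le hP1.le hz.2⟩
  set J : ℂ := ∫ z in a..b, G₀ z with hJ
  set R : ℂ := (∫ z in a..b, F (bigP D ^ z)) - J with hR
  have hRbd : ‖R‖ ≤ C₀ / ell D ^ 8 := by
    rw [hR, hJ, ← intervalIntegral.integral_sub hFz hG₀]
    calc _ ≤ C₀ / ell D ^ 8 * |b - a| :=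
          intervalIntegral.norm_integral_le_of_norm_le_const fun z hz => by
            rw [Set.uIoc_of_le hab] at hz; exact happrox z ⟨hz.1.le, hz.2⟩
      _ ≤ C₀ / ell D ^ 8 * 1 := by
          gcongr; rw [abs_le]; constructor <;> linarith
      _ = C₀ / ell D ^ 8 := mul_one _
  -- (3) the algebra: with `𝔞 = 𝔠 L′²`, `X = (500𝔞/(θΛ))·R + 500L′²(N − 𝔠I)/(θΛ²)`
  have hΛ0 : ((Real.log (bigP D) : ℝ) : ℂ) ≠ 0 := by
    rw [hlogP]; exact_mod_cast (pow_pos hℓ0 9).ne'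
  have hθ0 : (θ : ℂ) ≠ 0 := by exact_mod_cast hθ.ne'
  set L1 : ℂ := deriv χ.LFunction 1 with hL1
  have h𝔞 : (frakA χ : ℂ) = (𝔠 : ℂ) * L1 ^ 2 := by
    rw [h𝔠, hL1]; exact frakA_eq_frakcD_mul_sq χ hχ1 hq
  have eX : (500 : ℂ) * L1 ^ 2 / (θ * (Real.log (bigP D) : ℂ) ^ 2) * N -
      500 * (frakA χ : ℂ) / (θ * (Real.log (bigP D) : ℂ)) * J =
      500 * (frakA χ : ℂ) / (θ * (Real.log (bigP D) : ℂ)) * R +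
        500 * L1 ^ 2 / (θ * (Real.log (bigP D) : ℂ) ^ 2) * (N - (𝔠 : ℂ) * I) := by
    have hIJ : I = ((Real.log (bigP D) : ℝ) : ℂ) * (R + J) := by rw [hsub, hR]; ring
    rw [h𝔞, hIJ]
    field_simp
    ring
  rw [eX]
  -- (4) sizes
  have hL1 : ‖L1‖ ≤ cL * ell D ^ 2 := norm_deriv_LFunction_one_le_sq χ hℓ3 hp
  have h𝔞n : ‖(frakA χ : ℂ)‖ ≤ (cL * ell D ^ 2) ^ 2 :=
    (norm_frakA_le_sq χ hχ1 hq).trans (by gcongr)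
  have hΛn : ‖((Real.log (bigP D) : ℝ) : ℂ)‖ = ell D ^ 9 := by
    rw [Complex.norm_real, hlogP, Real.norm_eq_abs, abs_of_pos (pow_pos hℓ0 9)]
  have hθn : ‖(θ : ℂ)‖ = θ := by rw [Complex.norm_real, Real.norm_eq_abs, abs_of_pos hθ]
  have t1 : ‖(500 : ℂ) * (frakA χ : ℂ) / (θ * (Real.log (bigP D) : ℂ)) * R‖ ≤
      500 * (cL * ell D ^ 2) ^ 2 / (θ * ell D ^ 9) * (C₀ / ell D ^ 8) := by
    rw [norm_mul, norm_div, norm_mul, norm_mul, hθn, hΛn]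
    have h500 : ‖(500 : ℂ)‖ ≤ 500 := by norm_num
    gcongr
  have t2 : ‖(500 : ℂ) * L1 ^ 2 / (θ * (Real.log (bigP D) : ℂ) ^ 2) * (N - (𝔠 : ℂ) * I)‖ ≤
      500 * (cL * ell D ^ 2) ^ 2 / (θ * (ell D ^ 9) ^ 2) * (C * (M + π * M') * ell D) := by
    rw [norm_mul, norm_div, norm_mul, norm_pow, norm_mul, norm_pow, hθn, hΛn]
    have h500 : ‖(500 : ℂ)‖ ≤ 500 := by norm_num
    gcongr
  have hsum : 500 * (cL * ell D ^ 2) ^ 2 / (θ * ell D ^ 9) * (C₀ / ell D ^ 8) +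
      500 * (cL * ell D ^ 2) ^ 2 / (θ * (ell D ^ 9) ^ 2) * (C * (M + π * M') * ell D) =
      K / ell D ^ 13 := by
    rw [hK]; field_simp
  have hfinal : K / ell D ^ 13 ≤ ε * alpha D := by
    rw [hα, div_le_iff₀ (pow_pos hℓ0 13), show ε * (π / ell D ^ 9) * ell D ^ 13 =
      ε * π * ell D ^ 4 by field_simp]
    have h1 : K / (ε * π) ≤ ell D := by
      linarith [div_nonneg (zero_le_one) hb1.le]
    have h2 : K ≤ ε * π * ell D := by rwa [div_le_iff₀ (by positivity), mul_comm] at h1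
    calc K ≤ ε * π * ell D := h2
      _ = ε * π * ell D ^ 1 := by ring
      _ ≤ ε * π * ell D ^ 4 := by gcongr; norm_num
  calc _ ≤ ‖(500 : ℂ) * (frakA χ : ℂ) / (θ * (Real.log (bigP D) : ℂ)) * R‖ +
        ‖(500 : ℂ) * L1 ^ 2 / (θ * (Real.log (bigP D) : ℂ) ^ 2) * (N - (𝔠 : ℂ) * I)‖ := norm_add_le _ _
    _ ≤ _ := add_le_add t1 t2
    _ = K / ell D ^ 13 := hsum
    _ ≤ ε * alpha D := hfinal

end Literature.NumberTheory.LFunctions.Zhang2022.RangeAverage
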